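import Summits.Ventures.Crystal3D.Theorems.StickyWulffConstantPolycrystalWulffBoundNearTwinReduction
import Summits.Ventures.Crystal3D.Theorems.StickyWulffConstantPolycrystalWulffBoundTwoGrainTwinFact

/-!
# `PolycrystalWulffBound`, lane P: the NEAR-TWIN REDUCTION for crux frames — the generic two-grain
# inequality NEAR THE TWIN from `TwoGrainTwinInequality` BY NAME
# (helper for crux `stmt-Ventures-19482` / v5 `stmt-Ventures-23911`; poly-p2 g22; memo C1-COST-g21 §7, Lemma 7.1)

Route `StickyWulffConstant` of the venture `Summits/Ventures/Crystal3D`, second prover lane (poly-p2).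
Companion of `…NearTwinReduction` (the body-level reduction `twoGrain_nearTwin`, p753018) and of the two
named facts of lane P, `TwoGrainTwinInequality` (co-axial pairs, charge `½`, p691000) and
`GenericTwoGrainInequality c` (non-co-axial pairs, kernel `Dsc 0` = closed unit ball).  The certified «∀R»
column proves the generic inequality by BOXES on the misorientation cell; a box count diverges at the
twin vertex Σ3 (the only co-axial misorientation).  This file closes that neighbourhood in the kernel,
modulo the co-axial named fact:

* `nearTwinPair_of_twoGrainTwinInequality` (support-gap form): `TwoGrainTwinInequality →` for every
  `c ≥ 1`, every `ε` with `2(2√5 − 1)ε ≤ √3/3` (`ε ≤ 0.0831`), all crux frames `A, B` with stacking axes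
  `m₀` of `A` and `m₁` of `B` (`Ax m₀ A A`, `Ax m₁ B B`) whose bodies satisfy the two ONE-SIDED gaps
  `h_{R_{m₀} W(A)}(ν) ≤ h_{W(B)}(ν) + ε‖ν‖` and `h_{R_{m₁} W(B)}(ν) ≤ h_{W(A)}(ν) + ε‖ν‖`
  (`R_m = ((ℝ ∙ m)ᗮ).reflection`, `h_K = supportFn K`), and every disjoint polyhedral pair `S₁, S₂` of
  finite volume:
  `6·2^{1/3}(√2|S₁ ∪ S₂|)^{2/3} ≤ [Per_{W A} S₁ − ι_{W A}(S₁,S₂)] + [Per_{W B} S₂ − ι_{W B}(S₂,S₁)] + c·ι_{Dsc 0}(S₁,S₂)`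
  — verbatim the conclusion of `GenericTwoGrainInequality c` for the pair `(A, B)`;
* `nearTwinFrames_of_twoGrainTwinInequality` (operator-norm form): the same conclusion for all frames
  with `‖B x − R_{m₀}(A x)‖ ≤ δ‖x‖` for all `x`, where `2(2√5 − 1)·√5·δ ≤ √3/3` (`δ ≤ 0.0372`, every `B`
  within `2.13°` of the twin frame `R_{m₀} ∘ A`): both support gaps hold with `ε = √5·δ`
  (`supportFn_image_le_of_norm_sub_le`: the support function of a body in `B̄(0,√5)` is `√5`-Lipschitz in
  the direction; the twin of `B` about the transported axis `B A⁻¹ m₀` is `(B A⁻¹) R_{m₀} W(A)`,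
  `reflection_perp_conj`), and `Ax` transports along `B A⁻¹`.

WHAT THIS IS NOT: a proof of either named fact; pairs farther than `2.13°` from the twin are the box
certificates' business (BOX1-g20 / C1-COST-g21), not the kernel's; the crux is not claimed; rung F-C1 not
moved.
-/

noncomputable section

open scoped BigOperators InnerProductSpace ENNReal Pointwise
open MeasureTheory Filter Set Metric

namespace Summit.Ventures.Crystal3D.Cruxes.PolycrystalWulffBound.PolyDensity

open Summit.Ventures.Crystal3D.Theorems
open Summit.Ventures.Crystal3D.Cruxes.TextureLiminf.TexShadow (per polytope supportFn E3)
open Literature.MathematicalPhysics.StatisticalMechanics (fccStacking barlowStacking IsHaggSeq)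
open Literature.Analysis.Convexity

/-! ### Support functions: Lipschitz in the direction; images under isometries -/

/-- **The support function of a body in `B̄(0,R)` is `R`-Lipschitz in the direction**:
`h_K(μ) ≤ h_K(μ') + R·‖μ − μ'‖` (`K` nonempty). -/
theorem supportFn_le_supportFn_add {K : Set E3} {R : ℝ} (hK : K ⊆ closedBall (0 : E3) R)
    (hne : K.Nonempty) (μ μ' : E3) : supportFn K μ ≤ supportFn K μ' + R * ‖μ - μ'‖ := by
  unfold supportFn
  refine csSup_le (hne.image _) ?_
  rintro _ ⟨y, hy, rfl⟩
  have hyR : ‖y‖ ≤ R := mem_closedBall_zero_iff.1 (hK hy)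
  have h1 : ⟪y, μ'⟫_ℝ ≤ sSup ((fun y : E3 => ⟪y, μ'⟫_ℝ) '' K) :=
    le_csSup (bddAbove_inner_image_of_isBounded (isBounded_closedBall.subset hK) μ') ⟨y, hy, rfl⟩
  have h2 : ⟪y, μ - μ'⟫_ℝ ≤ R * ‖μ - μ'‖ :=
    (real_inner_le_norm _ _).trans (mul_le_mul_of_nonneg_right hyR (norm_nonneg _))
  calc ⟪y, μ⟫_ℝ = ⟪y, μ'⟫_ℝ + ⟪y, μ - μ'⟫_ℝ := by rw [← inner_add_right, add_sub_cancel]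
    _ ≤ _ := add_le_add h1 h2

/-- **Support gap between two isometric copies of one body.**  For `K ⊆ B̄(0,R)` nonempty (`R ≥ 0`) and
linear isometries `g, h` with `‖g⁻¹ν − h⁻¹ν‖ ≤ δ‖ν‖` for all `ν`:
`h_{g K}(ν) ≤ h_{h K}(ν) + R·δ·‖ν‖` (`h_{g K}(ν) = h_K(g⁻¹ν)` and the Lipschitz bound). -/
theorem supportFn_image_le_of_norm_sub_le {K : Set E3} {R δ : ℝ} (hK : K ⊆ closedBall (0 : E3) R)
    (hne : K.Nonempty) (hR : 0 ≤ R) (g h : E3 ≃ₗᵢ[ℝ] E3)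
    (hgh : ∀ ν : E3, ‖g.symm ν - h.symm ν‖ ≤ δ * ‖ν‖) (ν : E3) :
    supportFn (g '' K) ν ≤ supportFn (h '' K) ν + R * δ * ‖ν‖ := by
  have h1 := supportFn_le_supportFn_add hK hne (g.symm ν) (h.symm ν)
  unfold supportFn at h1 ⊢
  rw [sSup_inner_image_image_linearIsometryEquiv g, sSup_inner_image_image_linearIsometryEquiv h]
  calc sSup ((fun y : E3 => ⟪y, g.symm ν⟫_ℝ) '' K)
      ≤ sSup ((fun y : E3 => ⟪y, h.symm ν⟫_ℝ) '' K) + R * ‖g.symm ν - h.symm ν‖ := h1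
    _ ≤ sSup ((fun y : E3 => ⟪y, h.symm ν⟫_ℝ) '' K) + R * (δ * ‖ν‖) := by
        gcongr
        exact hgh ν
    _ = _ := by ring

/-! ### Reflections across a plane through the origin: formula and conjugation -/

/-- `R_n x = x − 2⟪x, n⟫ n` for a unit `n` (`R_n = ((ℝ ∙ n)ᗮ).reflection`). -/
theorem reflection_perp_unit_apply {n : E3} (hn : ‖n‖ = 1) (x : E3) :
    (ℝ ∙ n)ᗮ.reflection x = x - (2 * ⟪x, n⟫_ℝ) • n := by
  rw [Submodule.reflection_orthogonal_apply, Submodule.reflection_singleton_apply, hn, real_inner_comm]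
  simp only [RCLike.ofReal_real_eq_id, id_eq, one_pow, div_one]
  rw [neg_sub, two_smul, ← add_smul, ← two_mul]

/-- **Conjugation**: `R_{Q m}(Q x) = Q (R_m x)` for a unit `m` and a linear isometry `Q`. -/
theorem reflection_perp_conj (Q : E3 ≃ₗᵢ[ℝ] E3) {m : E3} (hm : ‖m‖ = 1) (x : E3) :
    (ℝ ∙ Q m)ᗮ.reflection (Q x) = Q ((ℝ ∙ m)ᗮ.reflection x) := by
  have hQm : ‖Q m‖ = 1 := by rw [Q.norm_map, hm]
  rw [reflection_perp_unit_apply hQm, reflection_perp_unit_apply hm, map_sub, LinearIsometryEquiv.map_smul,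
    Q.inner_map_map]

/-! ### The near-twin reduction for crux frames -/

/-- **Near-twin reduction, support-gap form** (`TwoGrainTwinInequality` by name): see the module
docstring.  Proof: `twoGrain_nearTwin` (…NearTwinReduction) with `W₁ = W A`, `W₂ = W B`, the twin bodies
`R_{m₀} W(A)` (for grain 2) and `R_{m₁} W(B)` (for grain 1), the kernels `Dsc m₀`, `Dsc m₁ ⊆ B̄(0,1)`,
the two twin inequalities from the named fact (frames `A` / `B`), and the one-grain Wulff inequality
`polycrystalWulffBound_singleGrain` for each grain (`Poly` sets of finite volume have finite perimeter). -/
theorem nearTwinPair_of_twoGrainTwinInequality (hTG : TwoGrainTwinInequality) {c ε : ℝ} (hc : 1 ≤ c)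
    (hε : 2 * (2 * Real.sqrt 5 - 1) * ε ≤ Real.sqrt 3 / 3) :
    let Λ : Set (EuclideanSpace ℝ (Fin 3)) := Literature.MathematicalPhysics.StatisticalMechanics.fccStacking 1 (Real.sqrt (2 / 3));
    let Brl : (ℤ → ℤ) → Set (EuclideanSpace ℝ (Fin 3)) := Literature.MathematicalPhysics.StatisticalMechanics.barlowStacking 1 (Real.sqrt (2 / 3));
    let Ax : EuclideanSpace ℝ (Fin 3) → (EuclideanSpace ℝ (Fin 3) ≃ₗᵢ[ℝ] EuclideanSpace ℝ (Fin 3)) → (EuclideanSpace ℝ (Fin 3) ≃ₗᵢ[ℝ] EuclideanSpace ℝ (Fin 3)) → Prop := fun m A B => ∃ (L : EuclideanSpace ℝ (Fin 3) ≃ₗᵢ[ℝ] EuclideanSpace ℝ (Fin 3)) (s₁ s₂ : EuclideanSpace ℝ (Fin 3)) (σ σ' : ℤ → ℤ), Literature.MathematicalPhysics.StatisticalMechanics.IsHaggSeq σ ∧ Literature.MathematicalPhysics.StatisticalMechanics.IsHaggSeq σ' ∧ L (EuclideanSpace.single (2 : Fin 3) (1 : ℝ)) = m ∧ A '' Λ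 ⊆ (fun q => L q + s₁) '' Brl σ ∧ B '' Λ ⊆ (fun q => L q + s₂) '' Brl σ';
    let Φ : EuclideanSpace ℝ (Fin 3) → ℝ := fun ν => Real.sqrt 2 / 4 * ∑ᶠ w ∈ {w ∈ Λ | ‖w‖ = 1}, |⟪w, ν⟫_ℝ|;
    let Per : Set (EuclideanSpace ℝ (Fin 3)) → Set (EuclideanSpace ℝ (Fin 3)) → ℝ := fun K S => (⨆ (ξ : EuclideanSpace ℝ (Fin 3) → EuclideanSpace ℝ (Fin 3)) (_ : ContDiff ℝ 1 ξ ∧ HasCompactSupport ξ ∧ ∀ z, ξ z ∈ K), ENNReal.ofReal (∫ z in S, Literature.MathematicalPhysics.StatisticalMechanics.fieldDivergence ξ z)).toReal;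
    let ι : Set (EuclideanSpace ℝ (Fin 3)) → Set (EuclideanSpace ℝ (Fin 3)) → Set (EuclideanSpace ℝ (Fin 3)) → ℝ := fun K S₁ S₂ => (Per K S₁ + Per K S₂ - Per K (S₁ ∪ S₂)) / 2;
    let W : (EuclideanSpace ℝ (Fin 3) ≃ₗᵢ[ℝ] EuclideanSpace ℝ (Fin 3)) → Set (EuclideanSpace ℝ (Fin 3)) := fun A => {y | ∀ ν : EuclideanSpace ℝ (Fin 3), ⟪y, ν⟫_ℝ ≤ Φ (A.symm ν)};
    let Dsc : EuclideanSpace ℝ (Fin 3) → Set (EuclideanSpace ℝ (Fin 3)) := fun m => {y | ‖y‖ ≤ 1 ∧ ⟪y, m⟫_ℝ = 0};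
    let Poly : Set (EuclideanSpace ℝ (Fin 3)) → Prop := fun S => ∃ (k : ℕ) (H : Fin k → Finset ((EuclideanSpace ℝ (Fin 3)) × ℝ)), S = ⋃ i, ⋂ p ∈ H i, {x | ⟪p.1, x⟫_ℝ < p.2};
    ∀ (A B : EuclideanSpace ℝ (Fin 3) ≃ₗᵢ[ℝ] EuclideanSpace ℝ (Fin 3)) (m₀ m₁ : EuclideanSpace ℝ (Fin 3)),
      Ax m₀ A A → Ax m₁ B B →
      (∀ ν : EuclideanSpace ℝ (Fin 3),
        supportFn ((ℝ ∙ m₀)ᗮ.reflection '' W A) ν ≤ supportFn (W B) ν + ε * ‖ν‖) →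
      (∀ ν : EuclideanSpace ℝ (Fin 3),
        supportFn ((ℝ ∙ m₁)ᗮ.reflection '' W B) ν ≤ supportFn (W A) ν + ε * ‖ν‖) →
      ∀ S₁ S₂ : Set (EuclideanSpace ℝ (Fin 3)), Poly S₁ → Poly S₂ → volume S₁ < ⊤ → volume S₂ < ⊤ → Disjoint S₁ S₂ →
        6 * (2 : ℝ) ^ ((1 : ℝ) / 3) * (Real.sqrt 2 * (volume (S₁ ∪ S₂)).toReal) ^ ((2 : ℝ) / 3) ≤
          (Per (W A) S₁ - ι (W A) S₁ S₂) + (Per (W B) S₂ - ι (W B) S₂ S₁) + c * ι (Dsc 0) S₁ S₂ := by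
  intro Λ Brl Ax Φ Per ι W Dsc Poly A B m₀ m₁ hA hB hgap₂ hgap₁ S₁ S₂ hP₁ hP₂ hv₁ hv₂ hd
  -- the Wulff bodies and their mirror images
  have hWc : ∀ X : E3 ≃ₗᵢ[ℝ] E3, IsCompact (W X) := fun X => isCompact_cruxWulffBody X
  have hWv : ∀ X : E3 ≃ₗᵢ[ℝ] E3, Convex ℝ (W X) := fun X => convex_cruxWulffBody X
  have hW0 : ∀ X : E3 ≃ₗᵢ[ℝ] E3, (0 : E3) ∈ W X := fun X => zero_mem_cruxWulffBody X
  have hWs : ∀ X : E3 ≃ₗᵢ[ℝ] E3, -W X = W X := fun X => neg_cruxWulffBody_eq X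
  have hWR : ∀ X : E3 ≃ₗᵢ[ℝ] E3, W X ⊆ closedBall (0 : E3) (Real.sqrt 5) := fun X =>
    cruxWulffBody_subset_closedBall X
  have hWr : ∀ X : E3 ≃ₗᵢ[ℝ] E3, closedBall (0 : E3) (Real.sqrt 3) ⊆ W X := fun X =>
    closedBall_subset_cruxWulffBody X
  have himc : ∀ R X : E3 ≃ₗᵢ[ℝ] E3, IsCompact (R '' W X) := fun R X => (hWc X).image R.continuous
  have himv : ∀ R X : E3 ≃ₗᵢ[ℝ] E3, Convex ℝ (R '' W X) := fun R X =>
    (hWv X).linear_image R.toLinearEquiv.toLinearMap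
  have him0 : ∀ R X : E3 ≃ₗᵢ[ℝ] E3, (0 : E3) ∈ R '' W X := fun R X => ⟨0, hW0 X, map_zero R⟩
  have hims : ∀ R X : E3 ≃ₗᵢ[ℝ] E3, -(R '' W X) = R '' W X := by
    intro R X
    ext y
    simp only [Set.mem_neg, mem_image]
    constructor
    · rintro ⟨x, hx, hxy⟩
      refine ⟨-x, by rw [← hWs X]; simpa using hx, ?_⟩
      rw [map_neg, hxy, neg_neg]
    · rintro ⟨x, hx, rfl⟩
      refine ⟨-x, by rw [← hWs X]; simpa using hx, ?_⟩
      rw [map_neg]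
  -- the wall kernels
  have hDc : ∀ v : E3, IsCompact (Dsc v) := fun v =>
    Metric.isCompact_of_isClosed_isBounded
      ((isClosed_le continuous_norm continuous_const).inter
        (isClosed_eq (continuous_id.inner continuous_const) continuous_const))
      (Metric.isBounded_closedBall.subset (cruxDisc_subset_closedBall v))
  have hDv : ∀ v : E3, Convex ℝ (Dsc v) := fun v => convex_cruxDisc v
  have hD0 : ∀ v : E3, (0 : E3) ∈ Dsc v := fun v => zero_mem_cruxDisc v
  have hD1 : ∀ v : E3, Dsc v ⊆ closedBall (0 : E3) 1 := fun v => cruxDisc_subset_closedBall v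
  -- the support gaps against the unit ball
  have hball : ∀ ν : E3, supportFn (closedBall (0 : E3) 1) ν = ‖ν‖ := fun ν => by
    unfold supportFn
    rw [sSup_inner_image_closedBall zero_le_one, one_mul]
  have hgap₂' : ∀ ν : E3, supportFn ((ℝ ∙ m₀)ᗮ.reflection '' W A) ν ≤
      supportFn (W B) ν + ε * supportFn (closedBall (0 : E3) 1) ν := fun ν => by
    rw [hball]; exact hgap₂ ν
  have hgap₁' : ∀ ν : E3, supportFn ((ℝ ∙ m₁)ᗮ.reflection '' W B) ν ≤
      supportFn (W A) ν + ε * supportFn (closedBall (0 : E3) 1) ν := fun ν => by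
    rw [hball]; exact hgap₁ ν
  -- the one-grain Wulff inequality for each grain
  have hWulff₁ : 6 * (2 : ℝ) ^ ((1 : ℝ) / 3) * (Real.sqrt 2 * (volume S₁).toReal) ^ ((2 : ℝ) / 3) ≤
      per (W A) S₁ := polycrystalWulffBound_singleGrain A (hasFinitePerimeter_of_poly hP₁ hv₁) hv₁
  have hWulff₂ : 6 * (2 : ℝ) ^ ((1 : ℝ) / 3) * (Real.sqrt 2 * (volume S₂).toReal) ^ ((2 : ℝ) / 3) ≤
      per (W B) S₂ := polycrystalWulffBound_singleGrain B (hasFinitePerimeter_of_poly hP₂ hv₂) hv₂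
  -- the body-level reduction, fed with the two twin inequalities of the named fact
  have key := twoGrain_nearTwin hP₁ hP₂ hv₁ hv₂ hd (hWc A) (hWv A) (hW0 A) (hWs A) (hWc B) (hWv B)
    (hW0 B) (hWs B) (himc _ B) (himv _ B) (him0 _ B) (hims _ B) (himc _ A) (himv _ A) (him0 _ A)
    (hims _ A) (hDc m₀) (hDv m₀) (hD0 m₀) (hDc m₁) (hDv m₁) (hD0 m₁) (hWR A) (hWR B) (hWr A) (hWr B)
    (hD1 m₀) (hD1 m₁) hε hc hgap₂' hgap₁' hWulff₁ hWulff₂ (hTG A m₀ hA S₁ S₂ hP₁ hP₂ hv₁ hv₂ hd)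
    (hTG B m₁ hB S₂ S₁ hP₂ hP₁ hv₂ hv₁ hd.symm)
  -- `Dsc 0` is the closed unit ball
  have hDB : Dsc 0 = closedBall (0 : E3) 1 := by
    ext y
    show y ∈ {y : E3 | ‖y‖ ≤ 1 ∧ ⟪y, (0 : E3)⟫_ℝ = 0} ↔ y ∈ closedBall (0 : E3) 1
    rw [mem_setOf_eq, mem_closedBall_zero_iff, inner_zero_right]
    simp
  rw [← hDB] at key
  exact key

/-- **Near-twin reduction, operator-norm form** (`TwoGrainTwinInequality` by name): for crux frames `A, B`,
a stacking axis `m₀` of `A` and `δ` with `2(2√5 − 1)·√5·δ ≤ √3/3`, IF `‖B x − R_{m₀}(A x)‖ ≤ δ‖x‖` for all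
`x` (the frame `B` is `δ`-close in operator norm to the TWIN frame `R_{m₀} ∘ A`), THEN the generic-form
two-grain inequality holds for `(A, B)` at every wall constant `c ≥ 1`.  Proof: `B A⁻¹ m₀` is a stacking
axis of `B` (transport of `Ax` along the isometry `B A⁻¹`); `W X = X '' W(1)`; the two support gaps of
`nearTwinPair_of_twoGrainTwinInequality` hold with `ε = √5·δ` by `supportFn_image_le_of_norm_sub_le`
(`W(1) ⊆ B̄(0,√5)`) and the conjugation `R_{B A⁻¹ m₀} ∘ (B A⁻¹) = (B A⁻¹) ∘ R_{m₀}`. -/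
theorem nearTwinFrames_of_twoGrainTwinInequality (hTG : TwoGrainTwinInequality) {c δ : ℝ} (hc : 1 ≤ c)
    (hδ : 2 * (2 * Real.sqrt 5 - 1) * (Real.sqrt 5 * δ) ≤ Real.sqrt 3 / 3) :
    let Λ : Set (EuclideanSpace ℝ (Fin 3)) := Literature.MathematicalPhysics.StatisticalMechanics.fccStacking 1 (Real.sqrt (2 / 3));
    let Brl : (ℤ → ℤ) → Set (EuclideanSpace ℝ (Fin 3)) := Literature.MathematicalPhysics.StatisticalMechanics.barlowStacking 1 (Real.sqrt (2 / 3));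
    let Ax : EuclideanSpace ℝ (Fin 3) → (EuclideanSpace ℝ (Fin 3) ≃ₗᵢ[ℝ] EuclideanSpace ℝ (Fin 3)) → (EuclideanSpace ℝ (Fin 3) ≃ₗᵢ[ℝ] EuclideanSpace ℝ (Fin 3)) → Prop := fun m A B => ∃ (L : EuclideanSpace ℝ (Fin 3) ≃ₗᵢ[ℝ] EuclideanSpace ℝ (Fin 3)) (s₁ s₂ : EuclideanSpace ℝ (Fin 3)) (σ σ' : ℤ → ℤ), Literature.MathematicalPhysics.StatisticalMechanics.IsHaggSeq σ ∧ Literature.MathematicalPhysics.StatisticalMechanics.IsHaggSeq σ' ∧ L (EuclideanSpace.single (2 : Fin 3) (1 : ℝ)) = m ∧ A '' Λ ⊆ (fun q => L q + s₁) '' Brl σ ∧ B '' Λ ⊆ (fun q => L q + s₂) '' Brl σ';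
    let Φ : EuclideanSpace ℝ (Fin 3) → ℝ := fun ν => Real.sqrt 2 / 4 * ∑ᶠ w ∈ {w ∈ Λ | ‖w‖ = 1}, |⟪w, ν⟫_ℝ|;
    let Per : Set (EuclideanSpace ℝ (Fin 3)) → Set (EuclideanSpace ℝ (Fin 3)) → ℝ := fun K S => (⨆ (ξ : EuclideanSpace ℝ (Fin 3) → EuclideanSpace ℝ (Fin 3)) (_ : ContDiff ℝ 1 ξ ∧ HasCompactSupport ξ ∧ ∀ z, ξ z ∈ K), ENNReal.ofReal (∫ z in S, Literature.MathematicalPhysics.StatisticalMechanics.fieldDivergence ξ z)).toReal;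
    let ι : Set (EuclideanSpace ℝ (Fin 3)) → Set (EuclideanSpace ℝ (Fin 3)) → Set (EuclideanSpace ℝ (Fin 3)) → ℝ := fun K S₁ S₂ => (Per K S₁ + Per K S₂ - Per K (S₁ ∪ S₂)) / 2;
    let W : (EuclideanSpace ℝ (Fin 3) ≃ₗᵢ[ℝ] EuclideanSpace ℝ (Fin 3)) → Set (EuclideanSpace ℝ (Fin 3)) := fun A => {y | ∀ ν : EuclideanSpace ℝ (Fin 3), ⟪y, ν⟫_ℝ ≤ Φ (A.symm ν)};
    let Dsc : EuclideanSpace ℝ (Fin 3) → Set (EuclideanSpace ℝ (Fin 3)) := fun m => {y | ‖y‖ ≤ 1 ∧ ⟪y, m⟫_ℝ = 0};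
    let Poly : Set (EuclideanSpace ℝ (Fin 3)) → Prop := fun S => ∃ (k : ℕ) (H : Fin k → Finset ((EuclideanSpace ℝ (Fin 3)) × ℝ)), S = ⋃ i, ⋂ p ∈ H i, {x | ⟪p.1, x⟫_ℝ < p.2};
    ∀ (A B : EuclideanSpace ℝ (Fin 3) ≃ₗᵢ[ℝ] EuclideanSpace ℝ (Fin 3)) (m₀ : EuclideanSpace ℝ (Fin 3)), Ax m₀ A A →
      (∀ x : EuclideanSpace ℝ (Fin 3), ‖B x - (ℝ ∙ m₀)ᗮ.reflection (A x)‖ ≤ δ * ‖x‖) →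
      ∀ S₁ S₂ : Set (EuclideanSpace ℝ (Fin 3)), Poly S₁ → Poly S₂ → volume S₁ < ⊤ → volume S₂ < ⊤ → Disjoint S₁ S₂ →
        6 * (2 : ℝ) ^ ((1 : ℝ) / 3) * (Real.sqrt 2 * (volume (S₁ ∪ S₂)).toReal) ^ ((2 : ℝ) / 3) ≤
          (Per (W A) S₁ - ι (W A) S₁ S₂) + (Per (W B) S₂ - ι (W B) S₂ S₁) + c * ι (Dsc 0) S₁ S₂ := by
  intro Λ Brl Ax Φ Per ι W Dsc Poly A B m₀ hA hnear S₁ S₂ hP₁ hP₂ hv₁ hv₂ hd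
  -- the axis is a unit vector
  obtain ⟨L, s₁, s₂, σ, σ', hσ, hσ', hLm, hAΛ, hAΛ'⟩ := hA
  have hm₀ : ‖m₀‖ = 1 := by
    rw [← hLm, LinearIsometryEquiv.norm_map, PiLp.norm_single, norm_one]
  -- the transporting isometry `Q = B ∘ A⁻¹` and the transported axis `m₁ = Q m₀`
  obtain ⟨Q, hQ⟩ : ∃ Q : E3 ≃ₗᵢ[ℝ] E3, ∀ x, Q x = B (A.symm x) := ⟨A.symm.trans B, fun _ => rfl⟩
  -- `m₁` is a stacking axis of `B`
  have hB : Ax (Q m₀) B B := by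
    refine ⟨L.trans Q, Q s₁, Q s₂, σ, σ', hσ, hσ', ?_, ?_, ?_⟩
    · show Q (L (EuclideanSpace.single (2 : Fin 3) (1 : ℝ))) = Q m₀
      rw [hLm]
    · rintro _ ⟨p, hp, rfl⟩
      obtain ⟨q, hq, hqe⟩ := hAΛ ⟨p, hp, rfl⟩
      refine ⟨q, hq, ?_⟩
      show Q (L q) + Q s₁ = B p
      rw [← map_add, show L q + s₁ = A p from hqe, hQ, A.symm_apply_apply]
    · rintro _ ⟨p, hp, rfl⟩
      obtain ⟨q, hq, hqe⟩ := hAΛ' ⟨p, hp, rfl⟩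
      refine ⟨q, hq, ?_⟩
      show Q (L q) + Q s₂ = B p
      rw [← map_add, show L q + s₂ = A p from hqe, hQ, A.symm_apply_apply]
  -- the reference body `W(1)` and `W X = X '' W(1)`
  have hWX : ∀ X : E3 ≃ₗᵢ[ℝ] E3, W X = X '' W (LinearIsometryEquiv.refl ℝ E3) := fun X =>
    cruxWulffBody_eq_image_self X
  have hW₀R : W (LinearIsometryEquiv.refl ℝ E3) ⊆ closedBall (0 : E3) (Real.sqrt 5) :=
    cruxWulffBody_subset_closedBall _
  have hW₀ne : (W (LinearIsometryEquiv.refl ℝ E3)).Nonempty := ⟨0, zero_mem_cruxWulffBody _⟩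
  have h5 : 0 ≤ Real.sqrt 5 := Real.sqrt_nonneg 5
  -- gap 1: the twin of `A` about `m₀` against `B`
  have hgap₂ : ∀ ν : E3, supportFn ((ℝ ∙ m₀)ᗮ.reflection '' W A) ν ≤
      supportFn (W B) ν + Real.sqrt 5 * δ * ‖ν‖ := by
    intro ν
    rw [hWX A, hWX B, ← Set.image_comp, ← LinearIsometryEquiv.coe_trans]
    refine supportFn_image_le_of_norm_sub_le hW₀R hW₀ne h5 _ _ (fun μ => ?_) ν
    -- `‖A⁻¹ R_{m₀} μ − B⁻¹ μ‖ ≤ δ‖μ‖`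
    rw [LinearIsometryEquiv.symm_trans, LinearIsometryEquiv.trans_apply, Submodule.reflection_symm]
    set x : E3 := A.symm ((ℝ ∙ m₀)ᗮ.reflection μ) with hx
    have hxμ : (ℝ ∙ m₀)ᗮ.reflection (A x) = μ := by
      rw [hx, A.apply_symm_apply, Submodule.reflection_reflection]
    have hnx : ‖x‖ = ‖μ‖ := by
      rw [hx, A.symm.norm_map, LinearIsometryEquiv.norm_map]
    have hdiff : x - B.symm μ = B.symm (B x - (ℝ ∙ m₀)ᗮ.reflection (A x)) := by
      rw [map_sub, B.symm_apply_apply, hxμ]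
    rw [hdiff, B.symm.norm_map, ← hnx]
    exact hnear x
  -- gap 2: the twin of `B` about `Q m₀` against `A`
  have hgap₁ : ∀ ν : E3, supportFn ((ℝ ∙ Q m₀)ᗮ.reflection '' W B) ν ≤
      supportFn (W A) ν + Real.sqrt 5 * δ * ‖ν‖ := by
    intro ν
    rw [hWX A, hWX B, ← Set.image_comp, ← LinearIsometryEquiv.coe_trans]
    refine supportFn_image_le_of_norm_sub_le hW₀R hW₀ne h5 _ _ (fun μ => ?_) ν
    -- `‖B⁻¹ R_{Q m₀} μ − A⁻¹ μ‖ ≤ δ‖μ‖`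
    rw [LinearIsometryEquiv.symm_trans, LinearIsometryEquiv.trans_apply, Submodule.reflection_symm]
    set x : E3 := B.symm μ with hx
    have hμ : μ = Q (A x) := by rw [hQ, A.symm_apply_apply, hx, B.apply_symm_apply]
    have hrefl : (ℝ ∙ Q m₀)ᗮ.reflection μ = Q ((ℝ ∙ m₀)ᗮ.reflection (A x)) := by
      rw [hμ, reflection_perp_conj Q hm₀ (A x)]
    have hdiff : B.symm ((ℝ ∙ Q m₀)ᗮ.reflection μ) - A.symm μ =
        A.symm ((ℝ ∙ m₀)ᗮ.reflection (A x) - B x) := by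
      rw [hrefl, hQ, B.symm_apply_apply, map_sub, hx, B.apply_symm_apply]
    have hnx : ‖x‖ = ‖μ‖ := by rw [hx, B.symm.norm_map]
    rw [hdiff, A.symm.norm_map, norm_sub_rev, ← hnx]
    exact hnear x
  exact nearTwinPair_of_twoGrainTwinInequality hTG hc hδ A B m₀ (Q m₀) ⟨L, s₁, s₂, σ, σ', hσ, hσ',
    hLm, hAΛ, hAΛ'⟩ hB hgap₂ hgap₁ S₁ S₂ hP₁ hP₂ hv₁ hv₂ hd

end Summit.Ventures.Crystal3D.Cruxes.PolycrystalWulffBound.PolyDensity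

end
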